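import Summits.AtomisticToContinuum.Crystallization.Theorems.FreeSplittingCertificatesStrictSplittingRuleTorusModel442Defs
import Summits.AtomisticToContinuum.Crystallization.Theorems.FreeSplittingCertificatesStrictSplittingRuleTorusParamSym
import Summits.AtomisticToContinuum.Crystallization.Theorems.FreeSplittingCertificatesStrictSplittingRuleTorusParamEnclosureData
import Summits.AtomisticToContinuum.Crystallization.Theorems.FreeSplittingCertificatesStrictSplittingRuleTorusModel442BetaBox

/-!
# Torus model 4×4×2 with SYMBOLIC lattice parameters `(a,h)` (S-procedure-lifted variables) — the term lists of the box theorem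

Route `FreeSplittingCertificates`, crux `StrictSplittingRule` (stmt-AtomisticToContinuum-12560); unit b2b-freesplit-B (PART B, gen 3).
VALUE = certificate infrastructure for a FINITE model — not summit progress.

This is `…TorusModel442Defs` (the joint sitewise LMI of the 4×4×2 hcp torus) with the lattice parameters `(a,h)` kept SYMBOLIC, in
the form consumed by `…TorusParamSym` / `…TorusParamGlue` / `…TorusParamEnclosureData`:
* variables `v : Fin 195 → R` = the 192 displacement coordinates `u` followed by the 3 co-rotation parameters `θ` of the centre site
  (S-procedure lift: `θ` is FREE; the least-squares normal equations `J_kk(a,h)·θ_k = RHS_k(a,h)(u)` enter as the penalty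
  `μ·Σ_k (J_kk θ_k − RHS_k(u))²`, which vanishes on the constraint, so substituting `θ := Θ(a,h)u` recovers the model's inequality);
* every functional is `Σ_mono mono(a,h)·ℓ_mono(v)` with `mono ∈ {1, a, h}` and rational `ℓ_mono` of support ≤ 5 (relative positions are
  `V_b(d) = a·(x̂, ŷ, 0) + h·(0, 0, ẑ)` in the scaled frame with rational `x̂, ŷ, ẑ` — `hat`), every weight is a rational multiple of `1`,
  `W′(s_c)` or `W″(s_c)` at the squared length `s_c = σa² + τh²` of the bond's class (`Atom.w1 σ τ`, `Atom.w2 σ τ`);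
* a symbolic term is `(σ, ℓ, ℓ′)` with `σ = [(mono, q)]` (`Mono` = `a^i h^j ·` optional weight atom), so that the model's value at `(a,h)` is
  `evalS (modelS p) (monoVal ∘ Mono.atoms) v` and `collect` regroups it by monomial (308 of them).
The β table (`betaTable`), transfer tables (`tableClasses`), offsets, shells and cut-off decisions (at the box centre `(a₀,h₀)`) are those
of `…TorusModel442Defs`; the penalty weight is `μ = 300`.  Fidelity anchors: `#eval` fingerprints of `modelS` at the centre monomial
values agree with the independent Python construction `symmodel.py` (HOME code/partB/gen3-boxcert/, `symmodel_442.json` "fingerprints")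
— see the end of the file — and `symmodel.py` reproduces job1's λ_min at the centre (CERT.md §13).  [folklore]
-/

namespace Summit.AtomisticToContinuum.Crystallization.Theorems.StrictSplittingRuleTorusLMI

namespace Param442

/-- Monomial key `a^i · h^j · w` (`w` an optional LJ-weight atom). [folklore] -/
structure Mono where
  /-- exponent of `a` -/
  i : ℕ
  /-- exponent of `h` -/
  j : ℕ
  /-- optional weight atom `W′(σ,τ)` / `W″(σ,τ)` -/
  w : Option Atom
  deriving DecidableEq, Repr

namespace Mono
/-- `1`. [folklore] -/
def one : Mono := ⟨0, 0, none⟩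
/-- `a`. [folklore] -/
def ma : Mono := ⟨1, 0, none⟩
/-- `h`. [folklore] -/
def mh : Mono := ⟨0, 1, none⟩
/-- Product (at most one factor carries a weight atom). [folklore] -/
def mul (m n : Mono) : Mono := ⟨m.i + n.i, m.j + n.j, m.w.orElse fun _ => n.w⟩
/-- The atom list whose product is the monomial's value. [folklore] -/
def atoms (m : Mono) : List Atom := List.replicate m.i Atom.a ++ List.replicate m.j Atom.h ++ m.w.toList
end Mono

/-- Symbolic functional `Σ mono · ℓ_mono(v)` on the 195 lifted variables. [folklore] -/
abbrev SF := List (Mono × LinF 195)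
/-- Symbolic term `(σ, ℓ, ℓ′)`, `σ = [(mono, q), …]` (the shape of `STerm 195 Mono`). [folklore] -/
abbrev ST := List (Mono × ℚ) × LinF 195 × LinF 195

/-- A displacement functional viewed on the lifted variables. [folklore] -/
def liftF (ℓ : LinF 192) : LinF 195 := ℓ.map fun p => (Fin.castLE (by decide) p.1, p.2)
/-- `c · θ_k`. [folklore] -/
def thF (k : Fin 3) (c : ℚ) : LinF 195 := [(⟨192 + k.val, by omega⟩, c)]
/-- `u_{q,c} − u_{p,c}` on the lifted variables. [folklore] -/
def eRelL (p q : Site) (c : Fin 3) : LinF 195 := liftF (eRel p q c)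

/-- Rational direction data: `V_b(d) = a·(hat 0, hat 1, 0) + h·(0, 0, hat 2)` (scaled frame; cf. `V` of …442Defs). [folklore] -/
def hat (b : Bool) (d : Off) : Fin 3 → ℚ :=
  let kp : ℤ := if b then 0 else 1
  let dL : ℚ := ((Lk (kp + d.1) - Lk kp : ℤ) : ℚ)
  fun c => if c = 0 then (d.2.1 : ℚ) + (d.2.2 : ℚ) / 2 + dL / 2 else if c = 1 then (d.2.2 : ℚ) / 2 + dL / 6 else (d.1 : ℚ)

/-- The monomial carried by component `r` of a relative position (`a` in-plane, `h` vertical). [folklore] -/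
def cmono (r : Fin 3) : Mono := if r = 2 then Mono.mh else Mono.ma
/-- `σ` of the class: `|V|² = σa² + τh²`. [folklore] -/
def sigma (b : Bool) (d : Off) : ℚ := hat b d 0 ^ 2 + 3 * hat b d 1 ^ 2
/-- `τ` of the class. [folklore] -/
def tau (b : Bool) (d : Off) : ℚ := hat b d 2 ^ 2
/-- Weight monomial `W′(s_class)`. [folklore] -/
def w1m (b : Bool) (d : Off) : Mono := ⟨0, 0, some (Atom.w1 (sigma b d) (tau b d))⟩
/-- Weight monomial `W″(s_class)`. [folklore] -/
def w2m (b : Bool) (d : Off) : Mono := ⟨0, 0, some (Atom.w2 (sigma b d) (tau b d))⟩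

/-- `⟨V_b(d), u_q − u_p⟩_G = a·(x̂(u_q−u_p)₀ + 3ŷ(u_q−u_p)₁) + h·ẑ(u_q−u_p)₂`. [folklore] -/
def dotVS (b : Bool) (d : Off) (p q : Site) : SF :=
  [(Mono.ma, liftF (LinF.smul (gW 0 * hat b d 0) (eRel p q 0) ++ LinF.smul (gW 1 * hat b d 1) (eRel p q 1))),
    (Mono.mh, liftF (LinF.smul (gW 2 * hat b d 2) (eRel p q 2)))]

/-- `(W y)_r = (1/g_r) Σ_k C_y[r][k] θ_k` for `y = V_b(d)`, `C_y` column `k` = `E_k y` (pairs `(0,1),(0,2),(1,2)`: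
`(E_k y)_i = y_j`, `(E_k y)_j = −y_i`). [folklore] -/
def WyS (b : Bool) (d : Off) (r : Fin 3) : SF :=
  [(0 : Fin 3), 1, 2].flatMap fun k =>
    let i : Fin 3 := if k = 2 then 1 else 0
    let j : Fin 3 := if k = 0 then 1 else 2
    (if r = i then [(cmono j, thF k (hat b d j / gW r))] else []) ++
      (if r = j then [(cmono i, thF k (-(hat b d i) / gW r))] else [])

/-- Negation of a symbolic functional. [folklore] -/
def negSF (F : SF) : SF := F.map fun x => (x.1, LinF.smul (-1) x.2)

/-- Co-rotated residual `(u_q − u_m − W V_b(d))_c` (the rotation is the free `θ`). [folklore] -/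
def residS (b : Bool) (d : Off) (m q : Site) (c : Fin 3) : SF := (Mono.one, eRelL m q c) :: negSF (WyS b d c)

/-- Insert a (coordinate, coefficient) pair, merging with an existing entry of the same coordinate (cf. `insertAdd`). [folklore] -/
def insertAddL (p : Fin 195 × ℚ) : LinF 195 → LinF 195
  | [] => [p]
  | q :: t => if q.1 = p.1 then (q.1, q.2 + p.2) :: t else q :: insertAddL p t

/-- Merge repeated coordinates and drop zero coefficients (same functional, canonical shorter list). [folklore] -/
def cleanL (ℓ : LinF 195) : LinF 195 := (ℓ.foldr insertAddL []).filter fun p => p.2 ≠ 0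

/-- Normal form of a symbolic functional: entries with the same monomial concatenated (one entry per monomial, first-seen
order), zero coefficients and empty entries dropped.  (Same function; `symmodel.py` keeps functionals in this form.) [folklore] -/
def mergeSF (F : SF) : SF :=
  let ms := (F.map (·.1)).dedup
  (ms.map fun m => (m, cleanL ((F.filter fun x => x.1 = m).flatMap (·.2)))).filter fun x => x.2 ≠ []

/-- Weighted square `wc · wm · F(v)²`, expanded into symbolic terms (after normalising `F`). [folklore] -/
def sqS (wm : Mono) (wc : ℚ) (F : SF) : List ST :=
  let F' := mergeSF F
  F'.flatMap fun x => F'.map fun y => ([(wm.mul (x.1.mul y.1), wc)], x.2, y.2)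

/-- Weighted product `c · F(v) · G(v)`, expanded (after normalising). [folklore] -/
def bilS (c : ℚ) (F G : SF) : List ST :=
  let F' := mergeSF F
  let G' := mergeSF G
  F'.flatMap fun x => G'.map fun y => ([(x.1.mul y.1, c)], x.2, y.2)

/-- SUPPLY: `½W′(s)·g_c·(e − W V)_c²` (`c = 0,1,2`) and `W″(s)·⟨V, e⟩²` over the offsets within `4.02 a₀` (centre structure). [folklore] -/
def supplyS (p : Site) : List ST :=
  let b := parity p
  (offsets b Rc2).flatMap fun d =>
    let q := tadd p d
    sqS (w1m b d) (gW 0 / 2) (residS b d p q 0) ++ sqS (w1m b d) (gW 1 / 2) (residS b d p q 1) ++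
      sqS (w1m b d) (gW 2 / 2) (residS b d p q 2) ++ sqS (w2m b d) 1 (dotVS b d p q)

/-- κ-DEMAND (negative sign): `−κ₁⟨V s, e⟩² − κ₃ g_c (e − W V s)_c²` over the shell. [folklore] -/
def kappaS (p : Site) : List ST :=
  let b := parity p
  (shell b).flatMap fun s =>
    let q := tadd p s
    sqS Mono.one (-kappa1) (dotVS b s p q) ++ sqS Mono.one (-(kappa3 * gW 0)) (residS b s p q 0) ++
      sqS Mono.one (-(kappa3 * gW 1)) (residS b s p q 1) ++ sqS Mono.one (-(kappa3 * gW 2)) (residS b s p q 2)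

/-- READOUT form (negative sign) with the β table `btab`: `−½β(b_q)(p−q)(s)·g_c·(u_{q+s} − u_q − W V s)_c²`, same bonds as
`readoutTerms`. [folklore] -/
def readoutS (p : Site) (btab : List ((Bool × Off × Off) × ℚ)) : List ST :=
  let b := parity p
  (((0, 0, 0) : Off) :: offsets b Rc2).flatMap fun d =>
    let bq := if d.1 % 2 = 0 then b else !b
    let q := tadd p d
    Y1.flatMap fun s =>
      let bv := betaLookup btab bq (negOff d) s
      if bv = 0 then [] else
        if ipG (fun c => V b d c + V true s c) (fun c => V b d c + V true s c) ≤ Rc2 then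
          sqS Mono.one (-(bv / 2 * gW 0)) (residS true s q (tadd q s) 0) ++
            sqS Mono.one (-(bv / 2 * gW 1)) (residS true s q (tadd q s) 1) ++
            sqS Mono.one (-(bv / 2 * gW 2)) (residS true s q (tadd q s) 2)
        else []

/-- Diagonal of the normal matrix, split by monomial: `J_kk = α_k a² + β_k h²` (`J` is diagonal for the hcp shell). [folklore] -/
def Jdiag (b : Bool) (k : Fin 3) : ℚ × ℚ :=
  let i : Fin 3 := if k = 2 then 1 else 0
  let j : Fin 3 := if k = 0 then 1 else 2
  -- C[i][k] = y_j contributes hat_j²/g_i to the monomial of component j; C[j][k] = −y_i contributes hat_i²/g_j to that of i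
  ((shell b).map fun s =>
      ((if j = 2 then 0 else hat b s j ^ 2 / gW i) + (if i = 2 then 0 else hat b s i ^ 2 / gW j),
        (if j = 2 then hat b s j ^ 2 / gW i else 0) + (if i = 2 then hat b s i ^ 2 / gW j else 0))).foldl
    (fun acc x => (acc.1 + x.1, acc.2 + x.2)) (0, 0)

/-- `RHS_k(u) = Σ_{s ∈ shell} Σ_r C_s[r][k] (u_{p+s} − u_p)_r` (symbolic). [folklore] -/
def rhsS (p : Site) (k : Fin 3) : SF :=
  let b := parity p
  let i : Fin 3 := if k = 2 then 1 else 0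
  let j : Fin 3 := if k = 0 then 1 else 2
  (shell b).flatMap fun s =>
    let q := tadd p s
    [(cmono j, LinF.smul (hat b s j) (eRelL p q i)), (cmono i, LinF.smul (-(hat b s i)) (eRelL p q j))]

/-- The penalty weight `μ`. [folklore] -/
def mu : ℚ := 300

/-- S-procedure PENALTY `μ Σ_k (J_kk θ_k − RHS_k(u))²`. [folklore] -/
def penaltyS (p : Site) : List ST :=
  let b := parity p
  [(0 : Fin 3), 1, 2].flatMap fun k =>
    let F : SF := [(⟨2, 0, none⟩, thF k (Jdiag b k).1), (⟨0, 2, none⟩, thF k (Jdiag b k).2)] ++ negSF (rhsS p k)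
    sqS Mono.one mu F

/-- Symbolic bond elongations `dl(m)` (for the transfers). [folklore] -/
def dlS (m : Site) : List SF := (shell (parity m)).map fun s => dotVS (parity m) s m (tadd m s)

/-- TRANSFERS: `+X(dl(p), dl(p+d))` / `−X(dl(p−d), dl(p))` exactly as `transferTerms`. [folklore] -/
def transferS (p : Site) (tcls : List (Bool × Off × Bool × Bool × List ℤ)) : List ST :=
  let b := parity p
  tcls.flatMap fun cl =>
    let X := tableX cl.2.2.2.1 cl.2.2.2.2
    let pl1 : List (ℚ × List SF) := if cl.1 == b then [(1, dlS p ++ dlS (tadd p cl.2.1))] else []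
    let pl2 : List (ℚ × List SF) := if cl.2.2.1 == b then [(-1, dlS (tadd p (negOff cl.2.1)) ++ dlS p)] else []
    (pl1 ++ pl2).flatMap fun pz =>
      X.flatMap fun e => bilS (pz.1 * e.2.2 * (if e.1 = e.2.1 then 1 else 2)) (pz.2.getD e.1 []) (pz.2.getD e.2.1 [])

/-- The whole symbolic model at `p`: `S + T − κ − R(β̄) + penalty`. [folklore] -/
def modelS (p : Site) : List ST :=
  supplyS p ++ transferS p tableClasses ++ kappaS p ++ readoutS p betaTable ++ penaltyS p

/-! ## The fixed majorant list `E`: β-box readout majorant + margin − translation projector -/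

/-- Decoded β-box radii `((b, d, s), E_k)` from raw rows `[b, dk, di, dj, sk, si, sj, e]`, `E_k = e / 2⁵⁰`. [folklore] -/
def etabOf (raw : List (List ℤ)) : List ((Bool × Off × Off) × ℚ) :=
  raw.filterMap fun r =>
    match r with
    | [b, dk, di, dj, sk, si, sj, e] => some ((b == 1, (dk, di, dj), (sk, si, sj)), (e : ℚ) / 2 ^ 50)
    | _ => none

/-- The part of a (normalised) symbolic functional carrying monomial `m`. [folklore] -/
def partSF (F : SF) (m : Mono) : LinF 195 := ((mergeSF F).filter fun x => x.1 = m).flatMap (·.2)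

/-- β-BOX READOUT MAJORANT (plain terms): for every readout bond of `readoutTerms`/`readoutS` (ALL keys of the β-box table,
including those with `β̄ = 0`) and component `c`, with `r = r⁰ + a·rᵃ + h·rʰ` the co-rotated residual:
`E_k · (3/2)·g_c · ((r⁰)² + a_max²(rᵃ)² + h_max²(rʰ)²)` (`a_max = a₀ + Δ`, `h_max = h₀ + Δ`), which dominates
`E_k · ½ g_c · r(a,h)(v)²` on the box (Cauchy–Schwarz over the three monomial parts). [folklore] -/
def emajS (p : Site) (etab : List ((Bool × Off × Off) × ℚ)) (Δ : ℚ) : List (Term 195) :=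
  let b := parity p
  (((0, 0, 0) : Off) :: offsets b Rc2).flatMap fun d =>
    let bq := if d.1 % 2 = 0 then b else !b
    let q := tadd p d
    Y1.flatMap fun s =>
      let ev := betaLookup etab bq (negOff d) s
      if ev = 0 then [] else
        if ipG (fun c => V b d c + V true s c) (fun c => V b d c + V true s c) ≤ Rc2 then
          [(0 : Fin 3), 1, 2].flatMap fun c =>
            let r := residS true s q (tadd q s) c
            let w : ℚ := ev * (3 / 2) * gW c
            [(w, partSF r Mono.one, partSF r Mono.one), (w * (a0 + Δ) ^ 2, partSF r Mono.ma, partSF r Mono.ma),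
              (w * (h0 + Δ) ^ 2, partSF r Mono.mh, partSF r Mono.mh)]
        else []

/-- `g_c · u_{q,c}²` (Cartesian norm of the displacement part) on the lifted variables. [folklore] -/
def normL : List (Term 195) := normTerms.map fun t => (t.1, liftF t.2.1, liftF t.2.2)
/-- Translation projector terms on the lifted variables. [folklore] -/
def projL : List (Term 195) := projTerms.map fun t => (t.1, liftF t.2.1, liftF t.2.2)

/-- The FIXED list `E = (β-box majorant) + m·‖u‖² − Π(u)`: the box theorem concludes `evalQR E v ≤ (model at (a,h))(v)`. [folklore] -/
def fixedE (p : Site) (etab : List ((Bool × Off × Off) × ℚ)) (Δ m : ℚ) : List (Term 195) :=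
  emajS p etab Δ ++ normL.map (fun t => (m * t.1, t.2)) ++ projL.map (fun t => (-t.1, t.2))

/-! ## Keys and re-indexing by `Fin K` -/

/-- The distinct monomial keys of a symbolic term list (first-seen order; linear scan against the short key list). [folklore] -/
def keys (ts : List ST) : List Mono :=
  (ts.foldl (fun acc t => t.1.foldl (fun acc' p => if acc'.contains p.1 then acc' else p.1 :: acc') acc) []).reverse

/-- Re-index symbolic coefficients by position in `ks` (entries whose key is absent are dropped — none is, when
`ks = keys ts`). [folklore] -/
def reindex (K : ℕ) (ks : List Mono) (ts : List ST) : List (List (Fin K × ℚ) × LinF 195 × LinF 195) :=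
  ts.map fun t => (t.1.filterMap fun p =>
    let n := ks.findIdx (· == p.1)
    if h : n < K then some (⟨n, h⟩, p.2) else none, t.2)

/-- The `k`-th key's atom list (the monomial value is `monoVal (keyAtoms …)`, its enclosure `monoEnclQ …`). [folklore] -/
def keyAtoms (ks : List Mono) (k : ℕ) : List Atom := (ks.getD k Mono.one).atoms

/-! ## The data of the box certificate (per parity; closed terms, evaluated once) -/

/-- Box centre `a₀`. [folklore] -/
def a0q : ℚ := 97129 / 100000
/-- Box centre `h₀`. [folklore] -/
def h0q : ℚ := 39647 / 50000
/-- Box half-width `Δ = 10⁻⁴` (`hcpFamilyMin_enclosure`). [folklore] -/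
def dq : ℚ := 1 / 10000
/-- The margin certified on the whole box. [folklore] -/
def mBox : ℚ := 1 / 30
/-- Number of monomial keys (both parities). [folklore] -/
def K : ℕ := 308
/-- Decoded β-box radii. [folklore] -/
def etab442 : List ((Bool × Off × Off) × ℚ) := etabOf betaBoxRaw442

/-- Symbolic model, parity A (reference site `siteA`). [folklore] -/
def modelA : List ST := modelS siteA
/-- Symbolic model, parity B. [folklore] -/
def modelB : List ST := modelS siteB
/-- Monomial keys, parity A. [folklore] -/
def keysA : List Mono := keys modelA
/-- Monomial keys, parity B. [folklore] -/
def keysB : List Mono := keys modelB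
/-- Re-indexed symbolic model, parity A. [folklore] -/
def tsA : List (STerm 195 (Fin K)) := reindex K keysA modelA
/-- Re-indexed symbolic model, parity B. [folklore] -/
def tsB : List (STerm 195 (Fin K)) := reindex K keysB modelB
/-- Fixed list `E` (β-box majorant + `mBox‖u‖²` − Π), parity A. [folklore] -/
def EA : List (Term 195) := fixedE siteA etab442 dq mBox
/-- Fixed list `E`, parity B. [folklore] -/
def EB : List (Term 195) := fixedE siteB etab442 dq mBox
/-- Monomial pieces `P_k`, parity A. [folklore] -/
def PA (k : Fin K) : List (Term 195) := collect tsA k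
/-- Monomial pieces, parity B. [folklore] -/
def PB (k : Fin K) : List (Term 195) := collect tsB k
/-- Absolute majorants, parity A. [folklore] -/
def PabsA (k : Fin K) : List (Term 195) := absTerms (PA k)
/-- Absolute majorants, parity B. [folklore] -/
def PabsB (k : Fin K) : List (Term 195) := absTerms (PB k)
/-- Enclosure data of key `k`, parity A. [folklore] -/
def enclA (k : Fin K) : AffQ := monoEnclQ a0q h0q dq (keyAtoms keysA k.val)
/-- Enclosure data of key `k`, parity B. [folklore] -/
def enclB (k : Fin K) : AffQ := monoEnclQ a0q h0q dq (keyAtoms keysB k.val)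
/-- Corner term list, parity A, sign pattern `(sa, sh)`. [folklore] -/
def cornerA (sa sh : ℚ) : List (Term 195) :=
  cornerTerms dq PA PabsA (fun k => (enclA k).c₀) (fun k => (enclA k).c₁) (fun k => (enclA k).c₂) (fun k => (enclA k).ρ) EA sa sh
/-- Corner term list, parity B. [folklore] -/
def cornerB (sa sh : ℚ) : List (Term 195) :=
  cornerTerms dq PB PabsB (fun k => (enclB k).c₀) (fun k => (enclB k).c₁) (fun k => (enclB k).c₂) (fun k => (enclB k).ρ) EB sa sh

/-! ## Fingerprints at the box centre (fidelity anchors vs `symmodel.py`) -/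

/-- Value of a monomial at the centre `(a₀, h₀)` (exact). [folklore] -/
def monoValQ (m : Mono) : ℚ :=
  let wv : ℚ := match m.w with
    | none => 1
    | some (Atom.w1 σ τ) => ljW1 (σ * a0 ^ 2 + τ * h0 ^ 2)
    | some (Atom.w2 σ τ) => ljW2 (σ * a0 ^ 2 + τ * h0 ^ 2)
    | some Atom.a => a0
    | some Atom.h => h0
  a0 ^ m.i * h0 ^ m.j * wv

/-- `Σ` of the coefficients of a functional. [folklore] -/
def lsum (ℓ : LinF 195) : ℚ := (ℓ.map (·.2)).sum
/-- `Σ_i ℓ_i ℓ′_i` (multiset-aware). [folklore] -/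
def ldot (ℓ ℓ' : LinF 195) : ℚ := (ℓ.map fun p => p.2 * ((ℓ'.filter fun q => q.1 = p.1).map (·.2)).sum).sum
/-- Coefficient of variable `i` of `ℓ`. [folklore] -/
def lcoef (ℓ : LinF 195) (i : Fin 195) : ℚ := ((ℓ.filter fun q => q.1 = i).map (·.2)).sum
/-- Symbolic coefficient at the centre. [folklore] -/
def scoefQ (σ : List (Mono × ℚ)) : ℚ := (σ.map fun p => p.2 * monoValQ p.1).sum

/-- Fingerprints `(1ᵀM1, tr M, M₀₀, tr M_θθ)` of the symbolic model at the centre. [folklore] -/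
def fingerprints (ts : List ST) : ℚ × ℚ × ℚ × ℚ :=
  ts.foldl (fun acc t =>
    let c := scoefQ t.1
    (acc.1 + c * lsum t.2.1 * lsum t.2.2, acc.2.1 + c * ldot t.2.1 t.2.2,
      acc.2.2.1 + c * lcoef t.2.1 0 * lcoef t.2.2 0,
      acc.2.2.2 + c * (lcoef t.2.1 192 * lcoef t.2.2 192 + lcoef t.2.1 193 * lcoef t.2.2 193 + lcoef t.2.1 194 * lcoef t.2.2 194)))
    (0, 0, 0, 0)

end Param442

end Summit.AtomisticToContinuum.Crystallization.Theorems.StrictSplittingRuleTorusLMI
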